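import Literature.AnabelianGeometry.EtaleTheta.Discharge.Sec5TowerOfConnectedTemperoid

/-!
# [EtTh] §5 over `B^temp(Π^tp_X)⁰`: `Ker(ρ_N : Π^tp_X ↠ Aut_D(B_N^bs))` = the stabiliser of every point of `A_N^bs` (§5 p.331 / PDF p.105)

Mochizuki, *The étale theta function …*, Publ. RIMS **45** (2009), §5 p.331 (PDF p.105): "the natural surjective outer homomorphism
`Π^tp_X ↠ Aut_D(B_N^bs)`"; [SemiAnbd] Rmk. 3.1.3 [cite: MochizukiEtTh2009, §5 p.331 (PDF p.105)]
[cite: MochizukiSemiAnbd2006, Rmk 3.1.3 p.34].  Seat abc-iut-L2-t4 (§5 owner), ROW W3-L2-01 «§5 GENUINE DATA»; PROOF-ONLY.  Additive.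

abc-iut-L6-t23's Def. 4.1 (iii) binders at the carrier (`ThetaEnvData.dies_on_ker_of (rhoOfBiKummerData R ιX) hD1 hD2`, GAP
G-L6t23-1, G-L6t23-2) quantify over `k ∈ Π^tp_Ÿ` with `ρ k = 1`.  Here that kernel condition is made CONCRETE:
* `ThetaFrobenioid.rhoOfBiKummerData_eq_one_iff` (any §4 setting) — `ρ(g) = 1 ↔ ρ_{A_N}(ιX g) = 1` (`ρ` is the Galois surjection of
  `A_N^bs` conjugated by the isomorphism `(s^⊓_N)^bs`);
* `ThetaFrobenioid.rho_ofConnectedTemperoidData_eq_one_iff` — over the genuine connected base `B^temp(Π^tp_X)⁰`: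
  `ρ(g) = 1 ↔ ιX g` fixes a (hence every) point of the Galois `Π^tp_X`-set `A_N^bs`, i.e. `Ker ρ = ιX⁻¹(N_{A_N})`
  (`GaloisObjects.mem_ker_galoisSurjOf_iff_apply`); tower form `rho_atLevel_ofConnectedTemperoidFamily_eq_one_iff`.
So hD1 reads "the part of `Π^tp_Ÿ` fixing `A_N^bs` acts trivially on `μ_N`" = the `μ_N`-saturation of the base field of `A_N`
(Def. 4.1 (iii)(a)), print-faithfully.  HONEST FRAMING: kernel-checked; nothing of hD1/hD2 is discharged here; no side taken downstream.
-/

noncomputable section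

namespace Literature.AnabelianGeometry.EtaleTheta

open CategoryTheory Opposite Literature.AlgebraicGeometry.Frobenioids Literature.AnabelianGeometry.SemiGraphs
  Literature.AnabelianGeometry.SemiGraphs.GaloisObjects

universe u₀ v₀ u v w

namespace ThetaFrobenioid

section AnySetting

variable {K : Type u₀} [Field K] {X : SemiGraphs.TemperedArithmeticGroup.{u₀} K} {D₀ : Type u₀} [Category.{v₀} D₀]
  {V : FrdIMonoidStub.{w}} {T₀ : RealifiedDivisorMonoids (D₀ := D₀) V} {D : Type u} [Category.{v} D]
  {VD : FrdICatStub.{u, v, w} D} {S : BiKummerSetting X T₀ D VD}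
  {pullFrac : ∀ {A A' : S.C} (_ : A' ⟶ A), S.biratUnits A → S.biratUnits A'}
  {lv N : ℕ+} {T : ThetaEnvData.{max v w} N} {θ : S.biratUnits S.Aodot} {Bl : S.C}
  {Pl : S.FractionPair θ Bl} {Rl : S.NthRoot θ Pl lv pullFrac}
  (R : S.NthRoot Rl.root Rl.pair N pullFrac) (ιX : T.PiX ≃ₜ* X.Pi)

/-- **`ρ(g) = 1 ↔ ρ_{A_N}(ιX g) = 1`**: the kernel of `Π^tp_X ↠ Aut_D(B_N^bs)` (§5 p.331) is the kernel of the setting's Galois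
surjection at `A_N^bs`, read through `ιX` (conjugation by `(s^⊓_N)^bs` is injective).  [cite: MochizukiEtTh2009, §5 p.331 (PDF p.105)] -/
theorem rhoOfBiKummerData_eq_one_iff (g : T.PiX) :
    rhoOfBiKummerData R ιX g = 1 ↔ S.galoisSurj R.AN.base R.αData.isGalois (ιX g) = 1 := by
  rw [rhoOfBiKummerData_apply, MulEquiv.map_eq_one_iff]

end AnySetting

section Connected

variable {K : Type u₀} [Field K] {X : SemiGraphs.TemperedArithmeticGroup.{u₀} K} {D₀ : Type u₀} [Category.{v₀} D₀]
  {V : FrdIMonoidStub.{w}} {T₀ : RealifiedDivisorMonoids (D₀ := D₀) V}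
  {VD : FrdICatStub.{u₀ + 1, u₀, w} (ConnectedPart (BTemp X.Pi))}
  {tf : TemperedFrobenioid T₀ (ConnectedPart (BTemp X.Pi)) VD} {hZ : tf.monoidType = MonoidType.Z}
  {hP : ∀ A : (ConnectedPart (BTemp X.Pi))ᵒᵖ, IsPerfect (tf.Φ.carrier A)}
  {NH : Subgroup (Field.absoluteGaloisGroup K) → tf.category → ℕ+ → Prop} {A₀ : tf.category}
  {hA₀ : PreFrobenioid.IsFrobeniusTrivial tf.toElem A₀} {hA₀' : SemiGraphs.IsGaloisObj A₀.base.obj}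
  {pullFrac : ∀ {A A' : (BiKummerSetting.mkOfConnectedTemperoid X tf hZ hP NH A₀ hA₀ hA₀').C} (_ : A' ⟶ A),
    (BiKummerSetting.mkOfConnectedTemperoid X tf hZ hP NH A₀ hA₀ hA₀').biratUnits A →
      (BiKummerSetting.mkOfConnectedTemperoid X tf hZ hP NH A₀ hA₀ hA₀').biratUnits A'}
  {lv : ℕ+}
  {θ : (BiKummerSetting.mkOfConnectedTemperoid X tf hZ hP NH A₀ hA₀ hA₀').biratUnits
    (BiKummerSetting.mkOfConnectedTemperoid X tf hZ hP NH A₀ hA₀ hA₀').Aodot}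
  {Bl : (BiKummerSetting.mkOfConnectedTemperoid X tf hZ hP NH A₀ hA₀ hA₀').C}
  {Pl : (BiKummerSetting.mkOfConnectedTemperoid X tf hZ hP NH A₀ hA₀ hA₀').FractionPair θ Bl}
  {Rl : (BiKummerSetting.mkOfConnectedTemperoid X tf hZ hP NH A₀ hA₀ hA₀').NthRoot θ Pl lv pullFrac}

/-- **Over `B^temp(Π^tp_X)⁰`: `ρ_{A_N}`-kernel = stabiliser of every point of `A_N^bs`** — for an `N`-th root `R` over the genuine
connected setting, `galoisSurj_{A_N^bs}(x') = 1 ↔ x'` fixes the point `a` of the Galois `Π^tp_X`-set `A_N^bs` ([SemiAnbd] Rmk. 3.1.3: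
all stabilisers equal `N_{A_N}`).  [cite: MochizukiSemiAnbd2006, Rmk 3.1.3 p.34] -/
theorem galoisSurj_AN_eq_one_iff {N : ℕ+}
    (R : (BiKummerSetting.mkOfConnectedTemperoid X tf hZ hP NH A₀ hA₀ hA₀').NthRoot Rl.root Rl.pair N pullFrac)
    (a : R.AN.base.obj.obj.V) (x' : X.Pi) :
    (BiKummerSetting.mkOfConnectedTemperoid X tf hZ hP NH A₀ hA₀ hA₀').galoisSurj R.AN.base R.αData.isGalois x' = 1 ↔
      R.AN.base.obj.obj.ρ x' a = a := by
  rw [← MonoidHom.mem_ker, BiKummerSetting.ker_mkOfConnectedTemperoid_galoisSurj]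
  exact mem_ker_galoisSurjOf_iff_apply X.isTempered R.AN.base.obj R.αData.isGalois a x'

/-- **`Ker ρ_N = ιX⁻¹(N_{A_N})` for the §5 data over `B^temp(Π^tp_X)⁰`**: `ρ(g) = 1 ↔ ιX g` fixes the point `a` of `A_N^bs` — the
kernel condition of abc-iut-L6-t23's binders hD1/hD2 in concrete form.  [cite: MochizukiEtTh2009, §5 p.331 (PDF p.105)] -/
theorem rho_ofConnectedTemperoidData_eq_one_iff {N : ℕ+} {T : ThetaEnvData.{max u₀ w} N}
    (h : ModelFrobenioid.Hypotheses tf.divisorMonoid tf.ratFnFunctor)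
    (Q : FrobenioidTheta.ThetaSubquotientStub.{w} (ConnectedPart (BTemp X.Pi))) (odd_l : Odd (lv : ℕ))
    (R : (BiKummerSetting.mkOfConnectedTemperoid X tf hZ hP NH A₀ hA₀ hA₀').NthRoot Rl.root Rl.pair N pullFrac)
    (ιX : T.PiX ≃ₜ* X.Pi) (K' : Type w) [Field K'] (constEmb : K'ˣ →* tf.biratUnitsModel R.BN)
    (constEmb_injective : Function.Injective constEmb)
    (hinvc : ∀ g : Aut R.AN.base,
      pull tf.divisorMonoid g.hom (ModelFrobenioid.div R.pair.num) = ModelFrobenioid.div R.pair.num)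
    (hinvp : ∀ y : T.PiX, y ∈ T.PiYdd →
      pull tf.divisorMonoid ((BiKummerSetting.mkOfConnectedTemperoid X tf hZ hP NH A₀ hA₀ hA₀').galoisSurj R.AN.base
        R.αData.isGalois (ιX y)).hom (ModelFrobenioid.div R.pair.den) = ModelFrobenioid.div R.pair.den)
    (a : R.AN.base.obj.obj.V) (g : T.PiX) :
    (ofConnectedTemperoidData h Q odd_l R ιX K' constEmb constEmb_injective hinvc hinvp).ρ g = 1 ↔
      R.AN.base.obj.obj.ρ (ιX g) a = a := by
  change rhoOfBiKummerData R ιX g = 1 ↔ _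
  rw [rhoOfBiKummerData_eq_one_iff]
  exact galoisSurj_AN_eq_one_iff R a (ιX g)

/-- **Tower form**: at every level of `ofConnectedTemperoidFamily`, `ρ_N(g) = 1 ↔ ιX g` fixes the point `a` of `A_N^bs`.
[cite: MochizukiEtTh2009, §5 p.331 (PDF p.105)] -/
theorem rhoFamily_eq_one_iff {E : Set ℕ+} {𝒯 : ThetaEnvTower.{max u₀ w} E}
    (R : ∀ N : ℕ+, (BiKummerSetting.mkOfConnectedTemperoid X tf hZ hP NH A₀ hA₀ hA₀').NthRoot Rl.root Rl.pair N pullFrac)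
    (ιX : 𝒯.PiX ≃ₜ* X.Pi) (N : ℕ+) (a : (R N).AN.base.obj.obj.V) (g : 𝒯.PiX) :
    ThetaFrobenioidTower.rhoFamily R ιX N g = 1 ↔ (R N).AN.base.obj.obj.ρ (ιX g) a = a := by
  rw [ThetaFrobenioidTower.rhoFamily_apply, MulEquiv.map_eq_one_iff]
  exact galoisSurj_AN_eq_one_iff (R N) a (ιX g)

end Connected

end ThetaFrobenioid

end Literature.AnabelianGeometry.EtaleTheta

end
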